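import Summits.QuantumAdvantage.QuantumAdvantage.Theorems.SosSandwichPseudoBoundedAAClassicalCornerQueryOSSSAux
import HarnessLib

/-!
# Crux `PseudoBoundedAA` (stmt-QuantumAdvantage-15237, route SosSandwich) — the query-probability OSSS law on the
# classical corner: `Var[p] ≤ ¼ Σ_k w_k Σⱼ δⱼ(t_k)·√Infⱼ[p]` for mixtures of decision trees

Support file (`--supports stmt-QuantumAdvantage-15237`), sequel of
`Theorems/SosSandwichPseudoBoundedAAClassicalCornerQueryOSSSAux.lean` (`ClassicalCornerQueryOSSS.osss_queries`: the
two-function OSSS inequality with QUERY PROBABILITIES for the tree's `DecisionTree`).  Here the corollary on the classical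
corner `R_T ⊆ K_T` of the crux PB-AA:

* `sum_card_queries_le_depth` — `Σⱼ #{x : j ∈ t.queries x} ≤ 2^N·depth(t)`;
* **`boolVariance_le_sum_queryProb_sqrt_influence`** — for `p` on the cube a nonnegative mixture `Σ_k w_k [t_k accepts]`:
  `Var[p] ≤ ¼ Σ_k w_k Σⱼ δⱼ(t_k) √Infⱼ[p]` (`= ¼ Σⱼ δ̄ⱼ √Infⱼ[p]` with `δ̄ⱼ = Σ_k w_k·Pr_x[j ∈ t_k.queries x]`) — the genuine
  O'Donnell–Saks–Schramm–Servedio weights instead of the depth; refines `ClassicalCorner.exists_influence_ge_of_mixture`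
  (`Var ≤ D̄ √maxInf/4`) since `Σⱼ δ̄ⱼ ≤ D̄` (`sum_queryProb_le_avgDepth`); it is the proved `L¹`/`√Inf` companion of the
  conjectured `L²`-OSSS law `16 Var² ≤ C Σⱼ δ̄ⱼ Infⱼ` recorded in the hands' census for this crux;
* `boolVariance_le_sum_queryProb_sqrt_influence'` (the `δ̄ⱼ`-collected form), **`sixteen_variance_sq_le_sum_queryProb_mul`**
  (Cauchy–Schwarz square `16·Var² ≤ (Σⱼ δ̄ⱼ)·(Σⱼ δ̄ⱼ Infⱼ)` — the conjectured `L²`-OSSS law up to the single factor `Σⱼ δ̄ⱼ`)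
  and `sixteen_variance_sq_le_avgDepth_mul_sum_queryProb_influence` (`16·Var² ≤ D̄·Σⱼ δ̄ⱼ Infⱼ`).

Honest label: corner calibration of an open conjecture; no registered stub, crux or summit is closed.
Sources: O'Donnell–Saks–Schramm–Servedio FOCS 2005, Thm 3.2; O'Donnell 2014 §8.6; Aaronson–Ambainis arXiv:0911.0996,
Thm 8 and the remark following it.
-/

set_option linter.dupNamespace false

noncomputable section

namespace Summit.QuantumAdvantage.QuantumAdvantage.Theorems.SosSandwich

open Finset Function
open Literature.Computability.Complexity Literature.Computability.QuantumComplexity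

namespace ClassicalCornerQueryOSSS

variable {N : ℕ}

/-! ### The classical corner: `Var[p] ≤ ¼ Σⱼ δ̄ⱼ √Infⱼ[p]` -/

/-- `Σⱼ Pr_x[j ∈ t.queries x] ≤ depth(t)`: in counting form `Σⱼ #{x : j ∈ t.queries x} ≤ 2^N·depth(t)`
(`|t.queries x| ≤ depth`). [cite: Wolf2002, §2.1] -/
theorem sum_card_queries_le_depth (t : DecisionTree N) :
    ∑ j, ((Finset.univ.filter fun x : Fin N → Bool => j ∈ t.queries x).card : ℝ) ≤
      (2 : ℝ) ^ N * (t.depth : ℝ) := by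
  classical
  have h : ∑ j, ((Finset.univ.filter fun x : Fin N → Bool => j ∈ t.queries x).card : ℝ) =
      ∑ x : Fin N → Bool, ((t.queries x).card : ℝ) := by
    simp_rw [← Finset.sum_boole (R := ℝ)]
    rw [Finset.sum_comm]
    refine Finset.sum_congr rfl fun x _ => ?_
    rw [Finset.sum_boole]
    simp
  rw [h]
  calc ∑ x : Fin N → Bool, ((t.queries x).card : ℝ) ≤ ∑ x : Fin N → Bool, (t.depth : ℝ) :=
        Finset.sum_le_sum fun x _ => by exact_mod_cast DecisionTree.card_queries_le_depth t x
    _ = (2 : ℝ) ^ N * (t.depth : ℝ) := by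
        rw [Finset.sum_const, Finset.card_univ, BooleanCorner.card_cube_nat, nsmul_eq_mul]; push_cast; ring

/-- **The sharp OSSS law on the classical corner.** If the real polynomial `p` is on the cube a nonnegative mixture
`p(x) = Σ_{k∈s} w_k·[t_k accepts x]` of decision trees, then
`Var[p] ≤ ¼ Σ_k w_k Σⱼ δⱼ(t_k)·√Infⱼ[p]` (`= ¼ Σⱼ δ̄ⱼ √Infⱼ[p]`, `δ̄ⱼ = Σ_k w_k·Pr_x[j ∈ t_k.queries x]`, the mixture's
query probabilities; the `k`-sum is written outside) — the genuine
O'Donnell–Saks–Schramm–Servedio weights instead of the depth (`Σⱼ δ̄ⱼ ≤ D̄`, `sum_queryProb_le_avgDepth`).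
[cite: OdonnellEtAl2005, Thm 3.2] [cite: AaronsonAmbainis2014, Thm 8 and the remark following it] -/
theorem boolVariance_le_sum_queryProb_sqrt_influence {ι : Type*} (s : Finset ι) (w : ι → ℝ)
    (hw : ∀ k ∈ s, 0 ≤ w k) (t : ι → DecisionTree N) (p : MvPolynomial (Fin N) ℝ)
    (hp : ∀ x, evalBool p x = ∑ k ∈ s, w k * (if (t k).eval x = true then (1 : ℝ) else 0)) :
    boolVariance p ≤ (∑ k ∈ s, w k * ∑ j,
        (((Finset.univ.filter fun x : Fin N → Bool => j ∈ (t k).queries x).card : ℝ) / (2 : ℝ) ^ N) *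
          Real.sqrt (influence j p)) / 4 := by
  classical
  have h2N : (0 : ℝ) < (2 : ℝ) ^ N := by positivity
  set F : ι → (Fin N → Bool) → ℝ := fun k x => if (t k).eval x = true then (1 : ℝ) else 0 with hF
  set g := evalBool p with hgdef
  set M : Fin N → ℝ := fun j => (2 : ℝ) ^ N * Real.sqrt (influence j p) with hMdef
  have hM : ∀ j, 0 ≤ M j := fun j => by positivity
  have hg : ∀ j : Fin N, ∑ x, |g (update x j true) - g (update x j false)| ≤ M j := fun j =>
    ClassicalCorner.sum_abs_update_le_sqrt_influence p j
  -- linearity of the covariance in the first argument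
  have hFk : ∀ x, ∑ k ∈ s, w k * F k x = g x := fun x => by rw [hp x]
  have hPg : ∑ x, g x * g x = ∑ k ∈ s, w k * ∑ x, F k x * g x := by
    calc ∑ x, g x * g x = ∑ x, ∑ k ∈ s, w k * (F k x * g x) := by
          refine Finset.sum_congr rfl fun x _ => ?_
          rw [show g x * g x = (∑ k ∈ s, w k * F k x) * g x by rw [hFk x], Finset.sum_mul]
          exact Finset.sum_congr rfl fun k _ => by ring
      _ = ∑ k ∈ s, ∑ x, w k * (F k x * g x) := Finset.sum_comm
      _ = ∑ k ∈ s, w k * ∑ x, F k x * g x := Finset.sum_congr rfl fun k _ => by rw [Finset.mul_sum]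
  have hPs : ∑ x, g x = ∑ k ∈ s, w k * ∑ x, F k x := by
    calc ∑ x, g x = ∑ x, ∑ k ∈ s, w k * F k x := Finset.sum_congr rfl fun x _ => (hFk x).symm
      _ = ∑ k ∈ s, ∑ x, w k * F k x := Finset.sum_comm
      _ = ∑ k ∈ s, w k * ∑ x, F k x := Finset.sum_congr rfl fun k _ => by rw [Finset.mul_sum]
  have hlin : (2 : ℝ) ^ N * (∑ x, g x * g x) - (∑ x, g x) * (∑ x, g x)
      = ∑ k ∈ s, w k * ((2 : ℝ) ^ N * (∑ x, F k x * g x) - (∑ x, F k x) * (∑ x, g x)) := by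
    rw [hPg, show (∑ x, g x) * (∑ x, g x) = (∑ k ∈ s, w k * ∑ x, F k x) * (∑ x, g x) by rw [← hPs],
      Finset.mul_sum, Finset.sum_mul, ← Finset.sum_sub_distrib]
    exact Finset.sum_congr rfl fun k _ => by ring
  have hvar := BooleanCorner.sum_sq_sub_sq_sum_eq p
  rw [← hgdef] at hvar
  -- `4^N Var ≤ Σ_k w_k Σ_j cnt_{k j} M_j / 4`
  have hbound : (2 : ℝ) ^ N * ((2 : ℝ) ^ N * boolVariance p) ≤
      ∑ k ∈ s, w k * ((∑ j, ((Finset.univ.filter fun x : Fin N → Bool => j ∈ (t k).queries x).card : ℝ) * M j) / 4) := by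
    rw [← hvar, hlin]
    exact Finset.sum_le_sum fun k hk =>
      mul_le_mul_of_nonneg_left (osss_queries (t k) (F k) g M (fun x => rfl) hM hg) (hw k hk)
  -- rearrange
  have hk_eq : ∀ k, (∑ j, ((Finset.univ.filter fun x : Fin N → Bool => j ∈ (t k).queries x).card : ℝ) * M j) / 4 =
      (2 : ℝ) ^ N * ((2 : ℝ) ^ N * ((∑ j,
        (((Finset.univ.filter fun x : Fin N → Bool => j ∈ (t k).queries x).card : ℝ) / (2 : ℝ) ^ N) *
          Real.sqrt (influence j p)) / 4)) := by
    intro k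
    simp only [hMdef]
    have hne : (2 : ℝ) ^ N ≠ 0 := h2N.ne'
    calc (∑ j, ((Finset.univ.filter fun x : Fin N → Bool => j ∈ (t k).queries x).card : ℝ) *
            ((2 : ℝ) ^ N * Real.sqrt (influence j p))) / 4
        = (∑ j, (2 : ℝ) ^ N * ((2 : ℝ) ^ N *
            ((((Finset.univ.filter fun x : Fin N → Bool => j ∈ (t k).queries x).card : ℝ) / (2 : ℝ) ^ N) *
              Real.sqrt (influence j p)))) / 4 := by
          congr 1
          refine Finset.sum_congr rfl fun j _ => ?_
          field_simp
      _ = _ := by rw [← Finset.mul_sum, ← Finset.mul_sum]; ring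
  have hre : ∑ k ∈ s, w k * ((∑ j, ((Finset.univ.filter fun x : Fin N → Bool => j ∈ (t k).queries x).card : ℝ)
        * M j) / 4) =
      (2 : ℝ) ^ N * ((2 : ℝ) ^ N * ((∑ k ∈ s, w k * ∑ j,
        (((Finset.univ.filter fun x : Fin N → Bool => j ∈ (t k).queries x).card : ℝ) / (2 : ℝ) ^ N) *
          Real.sqrt (influence j p)) / 4)) := by
    rw [Finset.sum_congr rfl fun k _ => by rw [hk_eq k], Finset.sum_div, Finset.mul_sum, Finset.mul_sum]
    refine Finset.sum_congr rfl fun k _ => ?_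
    ring
  rw [hre] at hbound
  exact le_of_mul_le_mul_left (le_of_mul_le_mul_left hbound h2N) h2N

/-- `Σⱼ δ̄ⱼ ≤ D̄ = Σ_k w_k·depth(t_k)`: the query-probability law implies the tree's depth law
(`ClassicalCorner.exists_influence_ge_of_mixture`). [cite: OdonnellEtAl2005, Thm 3.2] -/
theorem sum_queryProb_le_avgDepth {ι : Type*} (s : Finset ι) (w : ι → ℝ) (hw : ∀ k ∈ s, 0 ≤ w k)
    (t : ι → DecisionTree N) :
    ∑ j, (∑ k ∈ s, w k *
        (((Finset.univ.filter fun x : Fin N → Bool => j ∈ (t k).queries x).card : ℝ) / (2 : ℝ) ^ N)) ≤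
      ∑ k ∈ s, w k * ((t k).depth : ℝ) := by
  classical
  have h2N : (0 : ℝ) < (2 : ℝ) ^ N := by positivity
  rw [Finset.sum_comm]
  refine Finset.sum_le_sum fun k hk => ?_
  rw [← Finset.mul_sum, ← Finset.sum_div]
  refine mul_le_mul_of_nonneg_left ?_ (hw k hk)
  rw [div_le_iff₀ h2N]
  calc ∑ j, ((Finset.univ.filter fun x : Fin N → Bool => j ∈ (t k).queries x).card : ℝ)
      ≤ (2 : ℝ) ^ N * ((t k).depth : ℝ) := sum_card_queries_le_depth (t k)
    _ = ((t k).depth : ℝ) * (2 : ℝ) ^ N := mul_comm _ _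

/-! ### The `δ̄`-form and the Cauchy–Schwarz square: `16·Var² ≤ (Σⱼ δ̄ⱼ)·(Σⱼ δ̄ⱼ Infⱼ)` -/

/-- The same law with the mixture's query probabilities `δ̄ⱼ = Σ_k w_k·#{x : j ∈ t_k.queries x}/2^N` collected per
coordinate: `Var[p] ≤ ¼ Σⱼ δ̄ⱼ √Infⱼ[p]`. [cite: OdonnellEtAl2005, Thm 3.2] -/
theorem boolVariance_le_sum_queryProb_sqrt_influence' {ι : Type*} (s : Finset ι) (w : ι → ℝ)
    (hw : ∀ k ∈ s, 0 ≤ w k) (t : ι → DecisionTree N) (p : MvPolynomial (Fin N) ℝ)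
    (hp : ∀ x, evalBool p x = ∑ k ∈ s, w k * (if (t k).eval x = true then (1 : ℝ) else 0)) :
    boolVariance p ≤ (∑ j, (∑ k ∈ s, w k *
        (((Finset.univ.filter fun x : Fin N → Bool => j ∈ (t k).queries x).card : ℝ) / (2 : ℝ) ^ N)) *
        Real.sqrt (influence j p)) / 4 := by
  refine (boolVariance_le_sum_queryProb_sqrt_influence s w hw t p hp).trans (le_of_eq ?_)
  congr 1
  simp_rw [Finset.mul_sum, Finset.sum_mul]
  rw [Finset.sum_comm]
  exact Finset.sum_congr rfl fun k _ => Finset.sum_congr rfl fun j _ => by ring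

/-- **Cauchy–Schwarz square of the query-probability law:** `16·Var[p]² ≤ (Σⱼ δ̄ⱼ)·(Σⱼ δ̄ⱼ·Infⱼ[p])` for every
nonnegative mixture of decision trees — exponent `2` in the variance, the genuine OSSS weights, and ONE extra factor
`Σⱼ δ̄ⱼ` (the expected number of distinct queries, `≤ D̄ ≤ T`).  The conjectured `L²`-OSSS law of the census
(`16 Var² ≤ C·Σⱼ δ̄ⱼ Infⱼ`, which would give the `(2,1)` law on `R_T`) is exactly this inequality WITHOUT that factor.
[cite: OdonnellEtAl2005, Thm 3.2] -/
theorem sixteen_variance_sq_le_sum_queryProb_mul {ι : Type*} (s : Finset ι) (w : ι → ℝ)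
    (hw : ∀ k ∈ s, 0 ≤ w k) (t : ι → DecisionTree N) (p : MvPolynomial (Fin N) ℝ)
    (hp : ∀ x, evalBool p x = ∑ k ∈ s, w k * (if (t k).eval x = true then (1 : ℝ) else 0)) :
    16 * boolVariance p ^ 2 ≤
      (∑ j, ∑ k ∈ s, w k *
          (((Finset.univ.filter fun x : Fin N → Bool => j ∈ (t k).queries x).card : ℝ) / (2 : ℝ) ^ N)) *
      (∑ j, (∑ k ∈ s, w k *
          (((Finset.univ.filter fun x : Fin N → Bool => j ∈ (t k).queries x).card : ℝ) / (2 : ℝ) ^ N)) *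
        influence j p) := by
  classical
  set δ : Fin N → ℝ := fun j => ∑ k ∈ s, w k *
    (((Finset.univ.filter fun x : Fin N → Bool => j ∈ (t k).queries x).card : ℝ) / (2 : ℝ) ^ N) with hδ
  have hδ0 : ∀ j, 0 ≤ δ j := fun j =>
    Finset.sum_nonneg fun k hk => mul_nonneg (hw k hk) (by positivity)
  have hV0 : 0 ≤ boolVariance p := boolVariance_nonneg p
  have hmain := boolVariance_le_sum_queryProb_sqrt_influence' s w hw t p hp
  change boolVariance p ≤ (∑ j, δ j * Real.sqrt (influence j p)) / 4 at hmain
  change 16 * boolVariance p ^ 2 ≤ (∑ j, δ j) * (∑ j, δ j * influence j p)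
  have hS0 : 0 ≤ ∑ j, δ j * Real.sqrt (influence j p) :=
    Finset.sum_nonneg fun j _ => mul_nonneg (hδ0 j) (Real.sqrt_nonneg _)
  -- `16 Var² ≤ S²`
  have h1 : 16 * boolVariance p ^ 2 ≤ (∑ j, δ j * Real.sqrt (influence j p)) ^ 2 := by
    have h4 : 4 * boolVariance p ≤ ∑ j, δ j * Real.sqrt (influence j p) := by linarith
    nlinarith [h4, hV0]
  -- Cauchy–Schwarz: `S² ≤ (Σ δ)(Σ δ·Inf)`
  have h2 : (∑ j, δ j * Real.sqrt (influence j p)) ^ 2 ≤ (∑ j, δ j) * (∑ j, δ j * influence j p) := by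
    have hcs := Finset.sum_mul_sq_le_sq_mul_sq Finset.univ (fun j => Real.sqrt (δ j))
      (fun j => Real.sqrt (δ j) * Real.sqrt (influence j p))
    have hfg : ∀ j, Real.sqrt (δ j) * (Real.sqrt (δ j) * Real.sqrt (influence j p)) =
        δ j * Real.sqrt (influence j p) := by
      intro j; rw [← mul_assoc, Real.mul_self_sqrt (hδ0 j)]
    have hf2 : ∀ j, Real.sqrt (δ j) ^ 2 = δ j := fun j => Real.sq_sqrt (hδ0 j)
    have hg2 : ∀ j, (Real.sqrt (δ j) * Real.sqrt (influence j p)) ^ 2 = δ j * influence j p := by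
      intro j; rw [mul_pow, Real.sq_sqrt (hδ0 j), Real.sq_sqrt (influence_nonneg j p)]
    simp only [hfg, hf2, hg2] at hcs
    exact hcs
  exact h1.trans h2

/-- Depth form of the square: `16·Var[p]² ≤ D̄·(Σⱼ δ̄ⱼ·Infⱼ[p])`, `D̄ = Σ_k w_k depth(t_k)` — between the tree's
`16 Var² ≤ D̄²·maxInf` and the conjectured `16 Var² ≤ C·Σⱼ δ̄ⱼ Infⱼ`. [cite: OdonnellEtAl2005, Thm 3.2] -/
theorem sixteen_variance_sq_le_avgDepth_mul_sum_queryProb_influence {ι : Type*} (s : Finset ι) (w : ι → ℝ)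
    (hw : ∀ k ∈ s, 0 ≤ w k) (t : ι → DecisionTree N) (p : MvPolynomial (Fin N) ℝ)
    (hp : ∀ x, evalBool p x = ∑ k ∈ s, w k * (if (t k).eval x = true then (1 : ℝ) else 0)) :
    16 * boolVariance p ^ 2 ≤
      (∑ k ∈ s, w k * ((t k).depth : ℝ)) *
      (∑ j, (∑ k ∈ s, w k *
          (((Finset.univ.filter fun x : Fin N → Bool => j ∈ (t k).queries x).card : ℝ) / (2 : ℝ) ^ N)) *
        influence j p) := by
  refine (sixteen_variance_sq_le_sum_queryProb_mul s w hw t p hp).trans ?_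
  refine mul_le_mul_of_nonneg_right (sum_queryProb_le_avgDepth s w hw t) ?_
  exact Finset.sum_nonneg fun j _ => mul_nonneg
    (Finset.sum_nonneg fun k hk => mul_nonneg (hw k hk) (by positivity)) (influence_nonneg j p)

end ClassicalCornerQueryOSSS

end Summit.QuantumAdvantage.QuantumAdvantage.Theorems.SosSandwich

end
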